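import Literature.NumberTheory.ModularForms.DombLevelSixForms
import Literature.NumberTheory.ModularForms.DombEtaQuotientCMSigns
import Literature.NumberTheory.EllipticCurves.EtaQuotientQExpansionProofs
import Literature.NumberTheory.ModularForms.QExpansionAlgebra
import HarnessLib

/-!
# The first `q`-coefficients of the level-6 `η`-quotients `Z`, `Δ₆`, `W`

Seventh file of the level-6 story of the four-step random walk. Sturm's bound for weight `4` on
`Γ₀(6)` needs the coefficients `n ≤ 4`; here they are computed for the three `η`-quotients

* `Z = η(τ)⁴η(3τ)⁴/(η(2τ)²η(6τ)²)`:  `1, −4, 4, −4, 20`   (`dombModularForm_coeff_le_four`),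
* `Δ₆ = (η(τ)η(2τ)η(3τ)η(6τ))²`:      `0, 1, −2, −3, 4`    (`deltaSixForm_coeff_le_four`),
* `W = η(2τ)⁸η(6τ)⁸/(η(τ)⁴η(3τ)⁴)`:   `0, 0, 1, 4, 6`      (`wSixForm_coeff_le_four`),

from the tree's integral `q`-series `∏_{n≥1}(1 − q^{δn}) = Σ cₘ qᵐ`, `c = formalEulerScaled δ`
(`qExpansion_eulerFn`; pentagonal numbers `1, −1, −1, 0, 0`), truncated products
(`Trunc4`, `Trunc4.mul`) and, for the negative exponents, the triangular systems
`Z·(f₂²f₆²) = f₁⁴f₃⁴`, `W·(f₁⁴f₃⁴) = 𝕢²·f₂⁸f₆⁸` on `q`-expansions (`Trunc4.of_mul_eq`); the prefactor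
`e^{2πiτΣδr_δ/24}` is `1`, `𝕢`, `𝕢²` respectively (`etaQuotient_eq_cexp_mul_eulerUnit`).
Everything is proved; the numbers agree with a direct machine expansion (seat notes).

## References

* [BorweinEtAl2012] J. M. Borwein, A. Straub, J. Wan, W. Zudilin, *Densities of short uniform
  random walks*, Canad. J. Math. 64 (2012), §4 Remark 7 (the level-6 forms).
-/

noncomputable section

open UpperHalfPlane hiding I
open Complex Filter Topology Finset PowerSeries Function
open scoped Real MatrixGroups ModularForm Manifold

open Literature.NumberTheory.EllipticCurves.ModularForms
open Literature.NumberTheory.EllipticCurves (qExpansion_qParam periodic_qParam_one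
  mdifferentiable_qParam_one isBoundedAtImInfty_qParam_one)

namespace Literature.NumberTheory.ModularForms

/-! ### Truncated coefficient bookkeeping -/

/-- `coeff n (φψ) = Σ_{i ≤ n} coeff i φ · coeff (n−i) ψ`. [folklore] -/
theorem coeff_mul_eq_sum_range {R : Type*} [CommSemiring R] (φ ψ : PowerSeries R) (n : ℕ) :
    coeff n (φ * ψ) = ∑ i ∈ Finset.range (n + 1), coeff i φ * coeff (n - i) ψ := by
  rw [PowerSeries.coeff_mul, Finset.Nat.sum_antidiagonal_eq_sum_range_succ
    (fun i j => coeff i φ * coeff j ψ)]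

/-- The first five coefficients of a power series. [folklore] -/
def Trunc4 {R : Type*} [CommSemiring R] (φ : PowerSeries R) (a0 a1 a2 a3 a4 : R) : Prop :=
  coeff 0 φ = a0 ∧ coeff 1 φ = a1 ∧ coeff 2 φ = a2 ∧ coeff 3 φ = a3 ∧ coeff 4 φ = a4

/-- The coefficients `0..4` of a product, spelled out. [folklore] -/
theorem coeff_mul_le_four {R : Type*} [CommSemiring R] (φ ψ : PowerSeries R) :
    coeff 0 (φ * ψ) = coeff 0 φ * coeff 0 ψ ∧
      coeff 1 (φ * ψ) = coeff 0 φ * coeff 1 ψ + coeff 1 φ * coeff 0 ψ ∧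
        coeff 2 (φ * ψ) = coeff 0 φ * coeff 2 ψ + coeff 1 φ * coeff 1 ψ + coeff 2 φ * coeff 0 ψ ∧
          coeff 3 (φ * ψ) = coeff 0 φ * coeff 3 ψ + coeff 1 φ * coeff 2 ψ + coeff 2 φ * coeff 1 ψ +
            coeff 3 φ * coeff 0 ψ ∧
            coeff 4 (φ * ψ) = coeff 0 φ * coeff 4 ψ + coeff 1 φ * coeff 3 ψ + coeff 2 φ * coeff 2 ψ +
              coeff 3 φ * coeff 1 ψ + coeff 4 φ * coeff 0 ψ := by
  refine ⟨?_, ?_, ?_, ?_, ?_⟩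
  · rw [coeff_mul_eq_sum_range]
    simp only [Finset.sum_range_succ, Finset.sum_range_zero, zero_add, Nat.sub_self]
  · rw [coeff_mul_eq_sum_range]
    simp only [Finset.sum_range_succ, Finset.sum_range_zero, zero_add, Nat.sub_zero, Nat.sub_self]
  · rw [coeff_mul_eq_sum_range]
    simp only [Finset.sum_range_succ, Finset.sum_range_zero, zero_add, Nat.sub_zero, Nat.sub_self,
      show (2 : ℕ) - 1 = 1 from rfl]
  · rw [coeff_mul_eq_sum_range]
    simp only [Finset.sum_range_succ, Finset.sum_range_zero, zero_add, Nat.sub_zero, Nat.sub_self,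
      show (3 : ℕ) - 1 = 2 from rfl, show (3 : ℕ) - 2 = 1 from rfl]
  · rw [coeff_mul_eq_sum_range]
    simp only [Finset.sum_range_succ, Finset.sum_range_zero, zero_add, Nat.sub_zero, Nat.sub_self,
      show (4 : ℕ) - 1 = 3 from rfl, show (4 : ℕ) - 2 = 2 from rfl, show (4 : ℕ) - 3 = 1 from rfl]

/-- Truncated products. [folklore] -/
theorem Trunc4.mul {R : Type*} [CommRing R] {φ ψ : PowerSeries R}
    {a0 a1 a2 a3 a4 b0 b1 b2 b3 b4 c0 c1 c2 c3 c4 : R}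
    (hφ : Trunc4 φ a0 a1 a2 a3 a4) (hψ : Trunc4 ψ b0 b1 b2 b3 b4)
    (h0 : c0 = a0 * b0) (h1 : c1 = a0 * b1 + a1 * b0) (h2 : c2 = a0 * b2 + a1 * b1 + a2 * b0)
    (h3 : c3 = a0 * b3 + a1 * b2 + a2 * b1 + a3 * b0)
    (h4 : c4 = a0 * b4 + a1 * b3 + a2 * b2 + a3 * b1 + a4 * b0) :
    Trunc4 (φ * ψ) c0 c1 c2 c3 c4 := by
  obtain ⟨p0, p1, p2, p3, p4⟩ := hφ
  obtain ⟨q0, q1, q2, q3, q4⟩ := hψ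
  obtain ⟨m0, m1, m2, m3, m4⟩ := coeff_mul_le_four φ ψ
  refine ⟨?_, ?_, ?_, ?_, ?_⟩
  · rw [m0, p0, q0, h0]
  · rw [m1, p0, p1, q0, q1, h1]
  · rw [m2, p0, p1, p2, q0, q1, q2, h2]
  · rw [m3, p0, p1, p2, p3, q0, q1, q2, q3, h3]
  · rw [m4, p0, p1, p2, p3, p4, q0, q1, q2, q3, q4, h4]

/-- Truncated squares. [folklore] -/
theorem Trunc4.sq {R : Type*} [CommRing R] {φ : PowerSeries R} {a0 a1 a2 a3 a4 c0 c1 c2 c3 c4 : R}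
    (hφ : Trunc4 φ a0 a1 a2 a3 a4)
    (h0 : c0 = a0 * a0) (h1 : c1 = a0 * a1 + a1 * a0) (h2 : c2 = a0 * a2 + a1 * a1 + a2 * a0)
    (h3 : c3 = a0 * a3 + a1 * a2 + a2 * a1 + a3 * a0)
    (h4 : c4 = a0 * a4 + a1 * a3 + a2 * a2 + a3 * a1 + a4 * a0) :
    Trunc4 (φ ^ 2) c0 c1 c2 c3 c4 := by
  rw [pow_two]; exact Trunc4.mul hφ hφ h0 h1 h2 h3 h4

/-- Solving a triangular system `U · B = A` with `coeff 0 B = 1`. [folklore] -/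
theorem Trunc4.of_mul_eq {R : Type*} [CommRing R] {U B A : PowerSeries R}
    {b1 b2 b3 b4 a0 a1 a2 a3 a4 u0 u1 u2 u3 u4 : R} (h : U * B = A)
    (hB : Trunc4 B 1 b1 b2 b3 b4) (hA : Trunc4 A a0 a1 a2 a3 a4)
    (e0 : u0 = a0) (e1 : u1 = a1 - b1 * u0) (e2 : u2 = a2 - b1 * u1 - b2 * u0)
    (e3 : u3 = a3 - b1 * u2 - b2 * u1 - b3 * u0)
    (e4 : u4 = a4 - b1 * u3 - b2 * u2 - b3 * u1 - b4 * u0) :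
    Trunc4 U u0 u1 u2 u3 u4 := by
  obtain ⟨p0, p1, p2, p3, p4⟩ := hB
  obtain ⟨q0, q1, q2, q3, q4⟩ := hA
  obtain ⟨m0, m1, m2, m3, m4⟩ := coeff_mul_le_four U B
  rw [h] at m0 m1 m2 m3 m4
  rw [q0, p0] at m0
  rw [q1, p0, p1] at m1
  rw [q2, p0, p1, p2] at m2
  rw [q3, p0, p1, p2, p3] at m3
  rw [q4, p0, p1, p2, p3, p4] at m4
  have hu0 : coeff 0 U = u0 := by rw [e0]; linear_combination -m0
  have hu1 : coeff 1 U = u1 := by rw [e1, ← hu0]; linear_combination -m1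
  have hu2 : coeff 2 U = u2 := by rw [e2, ← hu0, ← hu1]; linear_combination -m2
  have hu3 : coeff 3 U = u3 := by rw [e3, ← hu0, ← hu1, ← hu2]; linear_combination -m3
  have hu4 : coeff 4 U = u4 := by rw [e4, ← hu0, ← hu1, ← hu2, ← hu3]; linear_combination -m4
  exact ⟨hu0, hu1, hu2, hu3, hu4⟩

/-- Ring maps act coefficientwise on truncations. [folklore] -/
theorem Trunc4.map {R S : Type*} [CommSemiring R] [CommSemiring S] (f : R →+* S) {φ : PowerSeries R}
    {a0 a1 a2 a3 a4 : R} (h : Trunc4 φ a0 a1 a2 a3 a4) :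
    Trunc4 (φ.map f) (f a0) (f a1) (f a2) (f a3) (f a4) := by
  obtain ⟨p0, p1, p2, p3, p4⟩ := h
  refine ⟨?_, ?_, ?_, ?_, ?_⟩ <;> simp [coeff_map, p0, p1, p2, p3, p4]

/-! ### The Euler products: pentagonal numbers -/

/-- `∏(1 − Xⁿ)`: coefficients `1, −1, −1, 0, 0`. [folklore] -/
theorem trunc4_formalEulerPow_one : Trunc4 (formalEulerPow 1) 1 (-1) (-1) 0 0 := by
  have h : ∀ n, n ≤ 4 → coeff n (formalEulerPow 1) = coeff n (eulerTrunc 1 4) := fun n hn =>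
    coeff_formalEulerPow hn
  -- `eulerTrunc 1 4 = (1−X)(1−X²)(1−X³)(1−X⁴)`, built up factor by factor
  have hprod : eulerTrunc 1 4 = (((1 - X) * (1 - X ^ 2)) * (1 - X ^ 3)) * (1 - X ^ 4) := by
    simp [eulerTrunc, Finset.prod_range_succ]
  have t1 : Trunc4 (1 - X : PowerSeries ℤ) 1 (-1) 0 0 0 := by
    refine ⟨?_, ?_, ?_, ?_, ?_⟩ <;> simp [coeff_one, coeff_X, map_sub]
  have t2 : Trunc4 (1 - X ^ 2 : PowerSeries ℤ) 1 0 (-1) 0 0 := by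
    refine ⟨?_, ?_, ?_, ?_, ?_⟩ <;> simp [coeff_one, coeff_X_pow, map_sub]
  have t3 : Trunc4 (1 - X ^ 3 : PowerSeries ℤ) 1 0 0 (-1) 0 := by
    refine ⟨?_, ?_, ?_, ?_, ?_⟩ <;> simp [coeff_one, coeff_X_pow, map_sub]
  have t4 : Trunc4 (1 - X ^ 4 : PowerSeries ℤ) 1 0 0 0 (-1) := by
    refine ⟨?_, ?_, ?_, ?_, ?_⟩ <;> simp [coeff_one, coeff_X_pow, map_sub]
  have t12 : Trunc4 ((1 - X) * (1 - X ^ 2) : PowerSeries ℤ) 1 (-1) (-1) 1 0 :=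
    t1.mul t2 (by norm_num) (by norm_num) (by norm_num) (by norm_num) (by norm_num)
  have t123 : Trunc4 (((1 - X) * (1 - X ^ 2)) * (1 - X ^ 3) : PowerSeries ℤ) 1 (-1) (-1) 0 1 :=
    t12.mul t3 (by norm_num) (by norm_num) (by norm_num) (by norm_num) (by norm_num)
  have t1234 : Trunc4 ((((1 - X) * (1 - X ^ 2)) * (1 - X ^ 3)) * (1 - X ^ 4) : PowerSeries ℤ)
      1 (-1) (-1) 0 0 :=
    t123.mul t4 (by norm_num) (by norm_num) (by norm_num) (by norm_num) (by norm_num)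
  rw [← hprod] at t1234
  obtain ⟨p0, p1, p2, p3, p4⟩ := t1234
  exact ⟨by rw [h 0 (by norm_num), p0], by rw [h 1 (by norm_num), p1], by rw [h 2 (by norm_num), p2],
    by rw [h 3 (by norm_num), p3], by rw [h 4 (by norm_num), p4]⟩

/-- `∏(1 − q^{δn})` truncated, `δ = 1, 2, 3, 6`. [folklore] -/
theorem trunc4_formalEulerScaled :
    Trunc4 (formalEulerScaled 1) 1 (-1) (-1) 0 0 ∧ Trunc4 (formalEulerScaled 2) 1 0 (-1) 0 (-1) ∧
      Trunc4 (formalEulerScaled 3) 1 0 0 (-1) 0 ∧ Trunc4 (formalEulerScaled 6) 1 0 0 0 0 := by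
  obtain ⟨p0, p1, p2, p3, p4⟩ := trunc4_formalEulerPow_one
  refine ⟨⟨?_, ?_, ?_, ?_, ?_⟩, ⟨?_, ?_, ?_, ?_, ?_⟩, ⟨?_, ?_, ?_, ?_, ?_⟩, ⟨?_, ?_, ?_, ?_, ?_⟩⟩ <;>
    simp only [coeff_formalEulerScaled] <;> norm_num [p0, p1, p2, p3, p4]

/-- The `q`-expansions of `∏(1 − q^{δn})` on `ℍ`, truncated (`δ = 1, 2, 3, 6`). [folklore] -/
theorem trunc4_qExpansion_eulerFn :
    Trunc4 (qExpansion 1 (eulerFn 1)) 1 (-1) (-1) 0 0 ∧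
      Trunc4 (qExpansion 1 (eulerFn 2)) 1 0 (-1) 0 (-1) ∧
        Trunc4 (qExpansion 1 (eulerFn 3)) 1 0 0 (-1) 0 ∧
          Trunc4 (qExpansion 1 (eulerFn 6)) 1 0 0 0 0 := by
  obtain ⟨h1, h2, h3, h6⟩ := trunc4_formalEulerScaled
  refine ⟨?_, ?_, ?_, ?_⟩
  · rw [qExpansion_eulerFn one_pos]; simpa using h1.map (Int.castRingHom ℂ)
  · rw [qExpansion_eulerFn (by norm_num : 0 < 2)]; simpa using h2.map (Int.castRingHom ℂ)
  · rw [qExpansion_eulerFn (by norm_num : 0 < 3)]; simpa using h3.map (Int.castRingHom ℂ)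
  · rw [qExpansion_eulerFn (by norm_num : 0 < 6)]; simpa using h6.map (Int.castRingHom ℂ)

/-! ### Niceness of the players -/

/-- `∏(1 − q^{δn})` is nice. [folklore] -/
theorem nice_eulerFn {δ : ℕ} (hδ : 0 < δ) :
    Periodic (eulerFn δ ∘ ofComplex) 1 ∧ MDiff (eulerFn δ) ∧ IsBoundedAtImInfty (eulerFn δ) :=
  ⟨periodic_eulerFn δ, mdifferentiable_eulerFn δ, isBoundedAtImInfty_eulerFn hδ⟩

/-- `𝕢₁` is nice. [folklore] -/
theorem nice_qParam :
    Periodic ((fun τ : ℍ => Periodic.qParam 1 (τ : ℂ)) ∘ ofComplex) 1 ∧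
      MDiff (fun τ : ℍ => Periodic.qParam 1 (τ : ℂ)) ∧
        IsBoundedAtImInfty (fun τ : ℍ => Periodic.qParam 1 (τ : ℂ)) :=
  ⟨periodic_qParam_one, mdifferentiable_qParam_one, isBoundedAtImInfty_qParam_one⟩

/-- An `η`-quotient of level `6` is nice. [folklore] -/
theorem nice_etaQuotient_of_modularForm {k : ℤ} (f : ModularForm (CongruenceSubgroup.Gamma0 6) k) :
    Periodic (⇑f ∘ ofComplex) 1 ∧ MDiff ⇑f ∧ IsBoundedAtImInfty ⇑f :=
  ⟨SlashInvariantFormClass.periodic_comp_ofComplex f (by simp), ModularFormClass.holo f,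
    ModularFormClass.bdd_at_infty f⟩

/-! ### The truncated products `f₁⁴f₃⁴`, `f₂²f₆²`, `f₁²f₂²f₃²f₆²`, `f₂⁸f₆⁸` -/

/-- Notation-free abbreviations for the four Euler functions as functions on `ℍ`. [folklore] -/
theorem trunc4_products :
    Trunc4 (qExpansion 1 (eulerFn 1 ^ 4 * eulerFn 3 ^ 4)) 1 (-4) 2 4 11 ∧
      Trunc4 (qExpansion 1 (eulerFn 2 ^ 2 * eulerFn 6 ^ 2)) 1 0 (-2) 0 (-1) ∧
        Trunc4 (qExpansion 1 (eulerFn 1 ^ 2 * eulerFn 2 ^ 2 * (eulerFn 3 ^ 2 * eulerFn 6 ^ 2)))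
          1 (-2) (-3) 4 6 ∧
          Trunc4 (qExpansion 1 (eulerFn 2 ^ 8 * eulerFn 6 ^ 8)) 1 0 (-8) 0 20 := by
  obtain ⟨e1, e2, e3, e6⟩ := trunc4_qExpansion_eulerFn
  have n1 := nice_eulerFn one_pos
  have n2 := nice_eulerFn (by norm_num : 0 < 2)
  have n3 := nice_eulerFn (by norm_num : 0 < 3)
  have n6 := nice_eulerFn (by norm_num : 0 < 6)
  -- powers of the single factors
  have e1_2 : Trunc4 (qExpansion 1 (eulerFn 1 ^ 2)) 1 (-2) (-1) 2 1 := by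
    rw [QExpansionAlgebra.qExpansion_pow_of_nice one_pos n1]
    exact e1.sq (by norm_num) (by norm_num) (by norm_num) (by norm_num) (by norm_num)
  have e1_4 : Trunc4 (qExpansion 1 (eulerFn 1 ^ 4)) 1 (-4) 2 8 (-5) := by
    rw [show eulerFn 1 ^ 4 = (eulerFn 1 ^ 2) ^ 2 by ring,
      QExpansionAlgebra.qExpansion_pow_of_nice one_pos (QExpansionAlgebra.nice_pow n1 2)]
    exact e1_2.sq (by norm_num) (by norm_num) (by norm_num) (by norm_num) (by norm_num)
  have e3_2 : Trunc4 (qExpansion 1 (eulerFn 3 ^ 2)) 1 0 0 (-2) 0 := by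
    rw [QExpansionAlgebra.qExpansion_pow_of_nice one_pos n3]
    exact e3.sq (by norm_num) (by norm_num) (by norm_num) (by norm_num) (by norm_num)
  have e3_4 : Trunc4 (qExpansion 1 (eulerFn 3 ^ 4)) 1 0 0 (-4) 0 := by
    rw [show eulerFn 3 ^ 4 = (eulerFn 3 ^ 2) ^ 2 by ring,
      QExpansionAlgebra.qExpansion_pow_of_nice one_pos (QExpansionAlgebra.nice_pow n3 2)]
    exact e3_2.sq (by norm_num) (by norm_num) (by norm_num) (by norm_num) (by norm_num)
  have e2_2 : Trunc4 (qExpansion 1 (eulerFn 2 ^ 2)) 1 0 (-2) 0 (-1) := by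
    rw [QExpansionAlgebra.qExpansion_pow_of_nice one_pos n2]
    exact e2.sq (by norm_num) (by norm_num) (by norm_num) (by norm_num) (by norm_num)
  have e2_4 : Trunc4 (qExpansion 1 (eulerFn 2 ^ 4)) 1 0 (-4) 0 2 := by
    rw [show eulerFn 2 ^ 4 = (eulerFn 2 ^ 2) ^ 2 by ring,
      QExpansionAlgebra.qExpansion_pow_of_nice one_pos (QExpansionAlgebra.nice_pow n2 2)]
    exact e2_2.sq (by norm_num) (by norm_num) (by norm_num) (by norm_num) (by norm_num)
  have e2_8 : Trunc4 (qExpansion 1 (eulerFn 2 ^ 8)) 1 0 (-8) 0 20 := by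
    rw [show eulerFn 2 ^ 8 = (eulerFn 2 ^ 4) ^ 2 by ring,
      QExpansionAlgebra.qExpansion_pow_of_nice one_pos (QExpansionAlgebra.nice_pow n2 4)]
    exact e2_4.sq (by norm_num) (by norm_num) (by norm_num) (by norm_num) (by norm_num)
  have e6_2 : Trunc4 (qExpansion 1 (eulerFn 6 ^ 2)) 1 0 0 0 0 := by
    rw [QExpansionAlgebra.qExpansion_pow_of_nice one_pos n6]
    exact e6.sq (by norm_num) (by norm_num) (by norm_num) (by norm_num) (by norm_num)
  have e6_8 : Trunc4 (qExpansion 1 (eulerFn 6 ^ 8)) 1 0 0 0 0 := by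
    have e6_4 : Trunc4 (qExpansion 1 (eulerFn 6 ^ 4)) 1 0 0 0 0 := by
      rw [show eulerFn 6 ^ 4 = (eulerFn 6 ^ 2) ^ 2 by ring,
        QExpansionAlgebra.qExpansion_pow_of_nice one_pos (QExpansionAlgebra.nice_pow n6 2)]
      exact e6_2.sq (by norm_num) (by norm_num) (by norm_num) (by norm_num) (by norm_num)
    rw [show eulerFn 6 ^ 8 = (eulerFn 6 ^ 4) ^ 2 by ring,
      QExpansionAlgebra.qExpansion_pow_of_nice one_pos (QExpansionAlgebra.nice_pow n6 4)]
    exact e6_4.sq (by norm_num) (by norm_num) (by norm_num) (by norm_num) (by norm_num)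
  refine ⟨?_, ?_, ?_, ?_⟩
  · rw [QExpansionAlgebra.qExpansion_mul_of_nice one_pos (QExpansionAlgebra.nice_pow n1 4)
      (QExpansionAlgebra.nice_pow n3 4)]
    exact e1_4.mul e3_4 (by norm_num) (by norm_num) (by norm_num) (by norm_num) (by norm_num)
  · rw [QExpansionAlgebra.qExpansion_mul_of_nice one_pos (QExpansionAlgebra.nice_pow n2 2)
      (QExpansionAlgebra.nice_pow n6 2)]
    exact e2_2.mul e6_2 (by norm_num) (by norm_num) (by norm_num) (by norm_num) (by norm_num)
  · have h12 : Trunc4 (qExpansion 1 (eulerFn 1 ^ 2 * eulerFn 2 ^ 2)) 1 (-2) (-3) 6 2 := by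
      rw [QExpansionAlgebra.qExpansion_mul_of_nice one_pos (QExpansionAlgebra.nice_pow n1 2)
        (QExpansionAlgebra.nice_pow n2 2)]
      exact e1_2.mul e2_2 (by norm_num) (by norm_num) (by norm_num) (by norm_num) (by norm_num)
    have h36 : Trunc4 (qExpansion 1 (eulerFn 3 ^ 2 * eulerFn 6 ^ 2)) 1 0 0 (-2) 0 := by
      rw [QExpansionAlgebra.qExpansion_mul_of_nice one_pos (QExpansionAlgebra.nice_pow n3 2)
        (QExpansionAlgebra.nice_pow n6 2)]
      exact e3_2.mul e6_2 (by norm_num) (by norm_num) (by norm_num) (by norm_num) (by norm_num)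
    rw [QExpansionAlgebra.qExpansion_mul_of_nice one_pos
      (QExpansionAlgebra.nice_mul (QExpansionAlgebra.nice_pow n1 2) (QExpansionAlgebra.nice_pow n2 2))
      (QExpansionAlgebra.nice_mul (QExpansionAlgebra.nice_pow n3 2) (QExpansionAlgebra.nice_pow n6 2))]
    exact h12.mul h36 (by norm_num) (by norm_num) (by norm_num) (by norm_num) (by norm_num)
  · rw [QExpansionAlgebra.qExpansion_mul_of_nice one_pos (QExpansionAlgebra.nice_pow n2 8)
      (QExpansionAlgebra.nice_pow n6 8)]
    exact e2_8.mul e6_8 (by norm_num) (by norm_num) (by norm_num) (by norm_num) (by norm_num)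

/-! ### `Z`: `Z · f₂²f₆² = f₁⁴f₃⁴` -/

/-- Expanding a product over the divisors of `6`. [folklore] -/
theorem prod_divisors_six (f : ℕ → ℂ) : ∏ δ ∈ (6 : ℕ).divisors, f δ = f 1 * f 2 * f 3 * f 6 := by
  rw [show (6 : ℕ).divisors = {1, 2, 3, 6} by decide]
  rw [Finset.prod_insert (by decide), Finset.prod_insert (by decide), Finset.prod_insert (by decide),
    Finset.prod_singleton]
  ring

/-- `Z(τ) · (f₂(τ)² f₆(τ)²) = f₁(τ)⁴ f₃(τ)⁴` (`Σ δr_δ = 0`). [folklore] -/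
theorem dombZ_mul_eq (τ : ℍ) :
    etaQuotient 6 dombExponents τ * (eulerFn 2 τ ^ 2 * eulerFn 6 τ ^ 2) =
      eulerFn 1 τ ^ 4 * eulerFn 3 τ ^ 4 := by
  have hS : (∑ δ ∈ (6 : ℕ).divisors, (δ : ℤ) * dombExponents δ) = 0 := by decide
  rw [etaQuotient_eq_prod_eulerFn_zpow 6 dombExponents hS τ, prod_divisors_six]
  simp only [dombExponents]
  norm_num
  have h2 := eulerFn_ne_zero (by norm_num : 0 < 2) τ
  have h6 := eulerFn_ne_zero (by norm_num : 0 < 6) τ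
  field_simp

/-- **`Z^∧(0..4) = 1, −4, 4, −4, 20`.** [folklore] -/
theorem dombModularForm_coeff_le_four :
    Trunc4 (qExpansion 1 (⇑dombModularForm)) 1 (-4) 4 (-4) 20 := by
  obtain ⟨hA, hB, -, -⟩ := trunc4_products
  have nZ := nice_etaQuotient_of_modularForm dombModularForm
  have n2 := nice_eulerFn (by norm_num : 0 < 2)
  have n6 := nice_eulerFn (by norm_num : 0 < 6)
  have hfun : (⇑dombModularForm) * (eulerFn 2 ^ 2 * eulerFn 6 ^ 2) = eulerFn 1 ^ 4 * eulerFn 3 ^ 4 := by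
    funext τ
    simp only [Pi.mul_apply, Pi.pow_apply, coe_dombModularForm]
    exact dombZ_mul_eq τ
  have hq : qExpansion 1 (⇑dombModularForm) * qExpansion 1 (eulerFn 2 ^ 2 * eulerFn 6 ^ 2) =
      qExpansion 1 (eulerFn 1 ^ 4 * eulerFn 3 ^ 4) := by
    rw [← QExpansionAlgebra.qExpansion_mul_of_nice one_pos nZ
      (QExpansionAlgebra.nice_mul (QExpansionAlgebra.nice_pow n2 2) (QExpansionAlgebra.nice_pow n6 2)),
      hfun]
  exact Trunc4.of_mul_eq hq hB hA (by norm_num) (by norm_num) (by norm_num) (by norm_num) (by norm_num)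

/-! ### `Δ₆ = 𝕢 · f₁²f₂²f₃²f₆²` and `W · f₁⁴f₃⁴ = 𝕢² · f₂⁸f₆⁸` -/

/-- `Δ₆(τ) = 𝕢₁(τ) · f₁²f₂²f₃²f₆²(τ)`. [folklore] -/
theorem deltaSix_eq_qParam_mul (τ : ℍ) :
    etaQuotient 6 deltaSixExponents τ =
      Periodic.qParam 1 (τ : ℂ) * (eulerFn 1 τ ^ 2 * eulerFn 2 τ ^ 2 * (eulerFn 3 τ ^ 2 * eulerFn 6 τ ^ 2)) := by
  have hS : (∑ δ ∈ (6 : ℕ).divisors, (δ : ℤ) * deltaSixExponents δ : ℤ) = 24 := by decide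
  have hpre : cexp (2 * π * I * (τ : ℂ) / 24 * (((24 : ℤ)) : ℂ)) = Periodic.qParam 1 (τ : ℂ) := by
    rw [Periodic.qParam]
    congr 1
    push_cast
    ring
  have hU : eulerUnit 6 deltaSixExponents τ =
      eulerFn 1 τ ^ 2 * eulerFn 2 τ ^ 2 * (eulerFn 3 τ ^ 2 * eulerFn 6 τ ^ 2) := by
    rw [eulerUnit, prod_divisors_six]
    simp [deltaSixExponents]
    simp only [zpow_two, pow_two]
    ring
  rw [etaQuotient_eq_cexp_mul_eulerUnit, hS, hpre, hU]

/-- `W(τ) · f₁⁴f₃⁴(τ) = 𝕢₁(τ)² · f₂⁸f₆⁸(τ)`. [folklore] -/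
theorem wSix_mul_eq (τ : ℍ) :
    etaQuotient 6 wSixExponents τ * (eulerFn 1 τ ^ 4 * eulerFn 3 τ ^ 4) =
      Periodic.qParam 1 (τ : ℂ) ^ 2 * (eulerFn 2 τ ^ 8 * eulerFn 6 τ ^ 8) := by
  have hS : (∑ δ ∈ (6 : ℕ).divisors, (δ : ℤ) * wSixExponents δ : ℤ) = 48 := by decide
  have hpre : cexp (2 * π * I * (τ : ℂ) / 24 * (((48 : ℤ)) : ℂ)) = Periodic.qParam 1 (τ : ℂ) ^ 2 := by
    rw [Periodic.qParam, ← Complex.exp_nat_mul]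
    congr 1
    push_cast
    ring
  have h1 := eulerFn_ne_zero one_pos τ
  have h3 := eulerFn_ne_zero (by norm_num : 0 < 3) τ
  have hU : eulerUnit 6 wSixExponents τ * (eulerFn 1 τ ^ 4 * eulerFn 3 τ ^ 4) =
      eulerFn 2 τ ^ 8 * eulerFn 6 τ ^ 8 := by
    rw [eulerUnit, prod_divisors_six]
    simp [wSixExponents, zpow_neg]
    field_simp
  rw [etaQuotient_eq_cexp_mul_eulerUnit, hS, hpre, mul_assoc, hU]

/-- `𝕢₁` and `𝕢₁²` truncated: `X`, `X²`. [folklore] -/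
theorem trunc4_qParam :
    Trunc4 (qExpansion 1 (fun τ : ℍ => Periodic.qParam 1 (τ : ℂ))) 0 1 0 0 0 ∧
      Trunc4 (qExpansion 1 ((fun τ : ℍ => Periodic.qParam 1 (τ : ℂ)) ^ 2)) 0 0 1 0 0 := by
  have hX : Trunc4 (qExpansion 1 (fun τ : ℍ => Periodic.qParam 1 (τ : ℂ))) 0 1 0 0 0 := by
    rw [qExpansion_qParam]
    refine ⟨?_, ?_, ?_, ?_, ?_⟩ <;> simp [coeff_X]
  refine ⟨hX, ?_⟩
  rw [QExpansionAlgebra.qExpansion_pow_of_nice one_pos nice_qParam]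
  exact hX.sq (by norm_num) (by norm_num) (by norm_num) (by norm_num) (by norm_num)

/-- **`Δ₆^∧(0..4) = 0, 1, −2, −3, 4`.** [folklore] -/
theorem deltaSixForm_coeff_le_four :
    Trunc4 (qExpansion 1 (⇑deltaSixForm)) 0 1 (-2) (-3) 4 := by
  obtain ⟨-, -, hP, -⟩ := trunc4_products
  obtain ⟨hX, -⟩ := trunc4_qParam
  have n1 := nice_eulerFn one_pos
  have n2 := nice_eulerFn (by norm_num : 0 < 2)
  have n3 := nice_eulerFn (by norm_num : 0 < 3)
  have n6 := nice_eulerFn (by norm_num : 0 < 6)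
  have hfun : (⇑deltaSixForm) = (fun τ : ℍ => Periodic.qParam 1 (τ : ℂ)) *
      (eulerFn 1 ^ 2 * eulerFn 2 ^ 2 * (eulerFn 3 ^ 2 * eulerFn 6 ^ 2)) := by
    funext τ
    simp only [Pi.mul_apply, Pi.pow_apply, coe_deltaSixForm]
    exact deltaSix_eq_qParam_mul τ
  rw [hfun, QExpansionAlgebra.qExpansion_mul_of_nice one_pos nice_qParam
    (QExpansionAlgebra.nice_mul (QExpansionAlgebra.nice_mul (QExpansionAlgebra.nice_pow n1 2)
      (QExpansionAlgebra.nice_pow n2 2)) (QExpansionAlgebra.nice_mul (QExpansionAlgebra.nice_pow n3 2)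
      (QExpansionAlgebra.nice_pow n6 2)))]
  exact hX.mul hP (by norm_num) (by norm_num) (by norm_num) (by norm_num) (by norm_num)

/-- **`W^∧(0..4) = 0, 0, 1, 4, 6`.** [folklore] -/
theorem wSixForm_coeff_le_four :
    Trunc4 (qExpansion 1 (⇑wSixForm)) 0 0 1 4 6 := by
  obtain ⟨hA, -, -, hC⟩ := trunc4_products
  obtain ⟨-, hX2⟩ := trunc4_qParam
  have nW := nice_etaQuotient_of_modularForm wSixForm
  have n1 := nice_eulerFn one_pos
  have n2 := nice_eulerFn (by norm_num : 0 < 2)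
  have n3 := nice_eulerFn (by norm_num : 0 < 3)
  have n6 := nice_eulerFn (by norm_num : 0 < 6)
  have hfun : (⇑wSixForm) * (eulerFn 1 ^ 4 * eulerFn 3 ^ 4) =
      (fun τ : ℍ => Periodic.qParam 1 (τ : ℂ)) ^ 2 * (eulerFn 2 ^ 8 * eulerFn 6 ^ 8) := by
    funext τ
    simp only [Pi.mul_apply, Pi.pow_apply, coe_wSixForm]
    exact wSix_mul_eq τ
  have hRHS : Trunc4 (qExpansion 1 ((fun τ : ℍ => Periodic.qParam 1 (τ : ℂ)) ^ 2 *
      (eulerFn 2 ^ 8 * eulerFn 6 ^ 8))) 0 0 1 0 (-8) := by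
    rw [QExpansionAlgebra.qExpansion_mul_of_nice one_pos (QExpansionAlgebra.nice_pow nice_qParam 2)
      (QExpansionAlgebra.nice_mul (QExpansionAlgebra.nice_pow n2 8) (QExpansionAlgebra.nice_pow n6 8))]
    exact hX2.mul hC (by norm_num) (by norm_num) (by norm_num) (by norm_num) (by norm_num)
  have hq : qExpansion 1 (⇑wSixForm) * qExpansion 1 (eulerFn 1 ^ 4 * eulerFn 3 ^ 4) =
      qExpansion 1 ((fun τ : ℍ => Periodic.qParam 1 (τ : ℂ)) ^ 2 * (eulerFn 2 ^ 8 * eulerFn 6 ^ 8)) := by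
    rw [← QExpansionAlgebra.qExpansion_mul_of_nice one_pos nW
      (QExpansionAlgebra.nice_mul (QExpansionAlgebra.nice_pow n1 4) (QExpansionAlgebra.nice_pow n3 4)),
      hfun]
  exact Trunc4.of_mul_eq hq hA hRHS (by norm_num) (by norm_num) (by norm_num) (by norm_num) (by norm_num)

end Literature.NumberTheory.ModularForms

end
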